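import Summits.QuantumFields.YangMills.Theorems.IR.Negative.TypShellCondFalseAllG.Composition

/-!
# Crux `IR` (stmt-QuantumFields-19354) — THE FIXED-MESH NEGATIVE FOR FORMAT T AND THE ONSET FLOOR FOR EVERY COMPACT
# GAUGE GROUP (sorry-free), part 8/8: the HEADLINE theorems `not_typShellCond_fixedMesh_allG`, `typOnsetFloor_allG`,
# the clipped-test forms `…_allG'` and the ROW-strength corollaries (section `Headline`)

Re-homed VERBATIM (statements, proofs, declaration names) from the crux workfile `Cruxes/IR/CruxIdea2FrameRowAllG.lean`
(rev 2, sha16 81bea4c546c46a61, 2159 lines; author: crux-ideate seat `ym-cruxidea-19354-2` GEN 6, planner, lens negation) per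
owner ruling R88 (ym-beyond-p2 g29, 2026-08-27T09:45:49Z: «GO on landing the all-G fixed-mesh negative as
`Theorems/IR/Negative/TypShellCondFalseAllG.lean` … `--supports stmt-QuantumFields-19354 --as helper`»; landing seat = the
`Negative/` lane, disprove-1 g6).  Only the module name and the namespace (`…Cruxes.IR.CruxIdea2g6` ↦ `…Cruxes.IR.FixedMeshAllG`)
changed; the 2159-line workfile is split by its own sections into eight modules of ≤ 400 lines (gate rule), chained by import:
`TypShellCondFalseAllG.{Laplace, Geometry, Comb, ZeroTemp, Frame, TreeGauge, Composition}` and the headline module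
`TypShellCondFalseAllG`.  Negative knowledge for the item; closes no registered stub; asserts no Theses statement.

The author's module docstring of the workfile follows VERBATIM (credit and reading of record; its «Namespace» sentence refers
to the workfile):

# Crux `IR` (stmt-QuantumFields-19354) — THE FRAME-TWIST ROW WITH BOTH NAMED INPUTS DISCHARGED:
# the fixed-mesh negative for format T and the onset floor FOR EVERY COMPACT GAUGE GROUP (sorry-free)

Crux-ideate seat `ym-cruxidea-19354-2` GEN 6 (planner, lens negation; count-neutral).  Crux workfile = scratch that
elaborates; nothing here is imported by a Theorems module.  Namespace `Summit.QuantumFields.YangMills.Cruxes.IR.CruxIdea2g6`.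

WHAT IS PROVED (no `sorry`; axioms `propext`, `Classical.choice`, `Quot.sound` — `#print axioms typOnsetFloor_allG`),
against the tree mirror `OnsetFormats.TypShellCond` of the registered format T (slot «af-pincer-Uc»: format Uc implies
it, `AfPincerUc.typShellCond_of_UKPc`):

* `not_typShellCond_fixedMesh_allG` — for EVERY compact (second countable) `G`, every continuous faithful unitary
  `ρ : G →* M_N(ℂ)`, `N ≥ 1`, EVERY `k₀ : G`, mesh `b ≥ 1`, window `n`, budgets `2ε < 1 − Re χ_ρ(k₀)/N`, `0 ≤ δ`,
  `4·#windowCellsPlus(n)·δ < 1`:  `∃ β₀ ∀ β ≥ β₀, ¬ TypShellCond ρ β b n ε δ`.  NO centre, NO scalar hypothesis — the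
  tree's `not_typShellCond_fixedMesh` (`Theorems/IR/Negative/TypShellCondFalseFixedMesh.lean`) needs a central `g₀` with
  `ρ g₀ = c • 1`, `c ≠ 1`; here `G` may be centre-free (`SO(3)`, `G₂`, `F₄`, `E₈`, `PSU(N)`) and `ρ` any faithful
  representation; `re_trace_div_lt_one`: the budget is satisfiable with `ε > 0` as soon as `k₀ ≠ 1`.
* `typOnsetFloor_allG` — the same uniformly on every bounded mesh range `1 ≤ b ≤ B`: the typical onset `b⋆_T(β)` (a
  fortiori `b⋆_Uc(β)`) exceeds every bound eventually, for every non-trivial compact gauge group (the route owner's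
  R74 (b) «onset-divergence-for-all-`G` datum»; R74 (c): the guard `HasScalarCentre` of certideate-2's row-onset split
  is NOT needed for divergence — only for the quantitative rate).
* rev 2 — THE CLIPPED TEST: `not_typShellCond_fixedMesh_allG'` ∕ `typOnsetFloor_allG'` — the same at EVERY budget
  `ε < 1` for every `k₀ ≠ 1` (shape the charged test by `ψ t = max (-1) (min 1 (2(t−r)/(1−r) − 1))`, `r = Re χ_ρ(k₀)/N`:
  frozen value `ψ 1 = 1`, twisted value `ψ r = −1`, separation `2`); `not_typShellCond_fixedMesh_of_nontrivial`
  (`[Nontrivial G]`, nothing to choose).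
* rev 2 — ROW STRENGTH and certideate-2's NAMED PROPS: `frame_core` derives the contradiction from PRIMITIVE data (a
  measurable cell-local class `Typ`, clause (i) asked ONLY at `Y = rowCells n` — `RowClauseI`, certideate-2's text
  verbatim — and the single-cell torus anchor on window+shell), so the weaker ROW formats fail too:
  `not_rowShellCond_fixedMesh_allG`, `not_rowShellCondUKP_fixedMesh_allG` (`k₀ ≠ 1`, `ε < 1`), and the Props
  `RowOnsetDivergesAny ρ`, `RowOnsetDivergesAll ρ`, `RowOnsetDivergesAnyU ρ` of `ym-19354-certideate-2/Sketch-g14.lean` §C∕§G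
  (texts copied verbatim, §11⁰) HOLD FOR EVERY `ρ`: `rowOnsetDivergesAny_allG`, `rowOnsetDivergesAll_allG`,
  `rowOnsetDivergesAnyU_allG` — the guard `HasScalarCentre` of the row-onset split is not a divergence guard (kernel fact).
* The two NAMED INPUTS of GEN 5's composition `not_typShellCond_frame` (tree `Cruxes/IR/CruxIdea2FrameRow.lean`
  7720daf266c53c8b, §1–§5 copied here verbatim into this namespace) are THEOREMS for the concrete field-dependent twist
  `κ = comb b ((2n+2)b+1) k₀` (the LAYER COMB: `k₀` transported from a root along a staircase inside the height-`(b+1)`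
  site layer): INPUT T `topTwistTransfer_comb` and INPUT F `frameValueBound_comb` (value `r = Re χ_ρ(k₀)/N`).

CHAIN (sections keep the seat's working numbers):
* §6 `laplace_upper_uniform` — an abstract UNIFORM soft Laplace upper bound: `X` compact with a finite open-positive
  measure, compact first-countable parameter space `Y`, continuous `S, g : Y × X → ℝ`, closed `K ⊆ Y`; if `g ≤ r` at
  every minimiser of `S(y,·)` for `y ∈ K`, then `∫ g e^{-βS} ≤ (r+s) ∫ e^{-βS}` for `β ≥ β₀` uniformly on an open
  `O ⊇ K` (compactness + closed projection; no rate, no Hessian).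
* g5 §1∕§3 (verbatim): the rim-top twist `topTwist b k ζ` (right-multiplies the vertical links from height `b` to `b+1`
  by `k(top)⁻¹`) IS the gauge transformation `layerGauge b k` on every row-layer cell and the identity off the row
  layer; the twisted staple `staple (topTwist b k ζ) = (A k_m A⁻¹) · staple ζ`.
* §7 the layer comb `comb b R k₀ ζ x = stair(x)⁻¹ k₀ stair(x)` (`zline`, `stair` along directions 1, 2, 3 from the root
  `(b+1,-R,-R,-R)`): covariantly constant along the comb links BY CONSTRUCTION (`stair_add_single_three`, `…_two_base`,
  `…_one_base`) and along every layer link for FLAT `ζ` (`layerCov_comb`, discrete Stokes); for flat `ζ` the twisted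
  datum is flat above the comb's base (`flat_topTwist`).
* §8 zero temperature: LOCAL planar Stokes (`col_mul_staple_eq_one_local`), zero Wilson action ⇒ flat torus
  (`torusFlat_of_wilsonAction_eq_zero`, faithfulness), zero boundary action of the twisted flat datum
  (`wilsonBoundaryAction_topTwist_eq_zero`) ⇒ every minimiser of the twisted row-region boundary action is flat on the
  touching plaquettes ⇒ the cell-`0` charged test read against the UNtwisted staple equals `Re χ_ρ(k₀)/N` EXACTLY at
  every minimiser (`chargedTest_re_eq_of_minimiser_comb`: `staple_topTwist` + covariance + `trace_rep_conj`).
* §9 INPUT F `frameValueBound_comb`: §6 with `Y` = the torus configurations (compact), `K` = the zero set of the Wilson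
  action, `S` = the twisted boundary action of the glued configuration, `g` = the charged test; the complement of `O`
  has positive minimal action, so torus plaquette FREEZING (`Freezing.tendsto_integral_wilsonMeasure`) + Markov make it
  `μ_β`-negligible; inside `O` the row kernel's twisted mean is `≤ r + η`.
* §10a `measurePreserving_gaugeTransform_dep` ∕ `wilsonMeasure_map_gaugeTransform_dep` — a CONFIGURATION-DEPENDENT gauge
  transformation `V ↦ V^{h(V)}` preserves product Haar (and the Wilson measure) whenever `h(V)` reads only links of a set
  `p` that the transformation fixes: skew product over the identity on `V|_p` with two-sided Haar translations in the
  fibres (`MeasurePreserving.skew_product`, `measurePreserving_piEquivPiSubtypeProd`); general in `d`, `L`, `p`, `h`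
  (ctriage-2 S-FTR-1: reusable by every `FixedMesh/` twisted pair).
* §10b INPUT T `topTwistTransfer_comb`: the comb's gauge tree on the torus of side `2R+1` read through centred
  representatives (`IsTreeEdge`, `treeGauge`, `treeGauge_dep`, `treeGauge_fix`), the row-layer∕off-layer case split of
  g5 §1, `cellEdges_endpoints_mem_box` + `Torus.cRep_proj_of_mem_box`; transport with EQUALITY.
* §11⁰ the row formats (certideate-2's defs verbatim); §11a (g5 §2 at row strength) clause (i) at the row ⇒
  two-kernel bound for the admissible pair `(ζ, topTwist b k ζ)` and any cell-`0` cylinder `|u| ≤ 1`; §11b `frame_core`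
  (rev 2: SHAPED test `ψ ∘ Re`, `|ψ| ≤ 1` on `[−1,1]`, domination `1 − ψ t ≤ A(1 − t)` transfers torus loop FREEZING to
  the shaped loop; properness `integral_comp_loopObs_eq`; INPUT F for `(κ, ψ)` = `FrameValueBoundObs`, for the comb
  and every continuous `ψ` = `frameValueBoundObs_comb`, value `ψ(r)`); `not_typShellCond_frame` = the case `ψ = id`;
  §11c the headlines (`frame_core_comb_clipped`: `ψ` = the clipped affine map, `A = 2/(1−r)`).

WHAT THIS IS NOT.  It refutes NO registered stub: `OnsetMixingTypicalUKPc` ∕ the tree's `OnsetMixingTypical` put `∃ b`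
AFTER `∀ β ≥ β₂` (`b = b(β)` may grow), and the freezing input lives on ONE torus of side `2((2n+2)b+1)+1` at fixed `b`
— it binds for `b ≪ ξ_G(β)` only (numbers: tree `TypShellCondFalseFixedMesh` READING).  No estimate is proved here: every
step is soft (compactness, exact gauge covariance, exact lattice Stokes, dominated convergence in the tree's freezing).
Budgets: the character test gives `2ε < 1 − Re χ_ρ(k₀)/N` (rev 1 headline); the clipped test gives EVERY `ε < 1` (rev 2).
Axiom audit (`#print axioms`, rev 2): `rowOnsetDivergesAny_allG`, `rowOnsetDivergesAnyU_allG`,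
`not_typShellCond_fixedMesh_allG'`, `typOnsetFloor_allG` depend on `[propext, Classical.choice, Quot.sound]` only.
-/

set_option autoImplicit false

noncomputable section

open MeasureTheory Filter Topology
open Literature.MathematicalPhysics.QuantumLattice
open Literature.Probability.LatticeModels
open Summit.QuantumFields.YangMills.Cruxes.IR.Tempered (cellEdges windowCells regionEdges)
open Summit.QuantumFields.YangMills.Cruxes.IR.ShellTempered (windowCellsPlus)
open Summit.QuantumFields.YangMills.Cruxes.IR.OnsetFormats (TypShellCond shellCount)
open Summit.QuantumFields.YangMills.Cruxes.IR.FixedMesh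

namespace Summit.QuantumFields.YangMills.Cruxes.IR.FixedMeshAllG

/-! ## §11c HEADLINE (PROVED, sorry-free): format T∕U clause (i) fails at every fixed mesh for EVERY compact `G` -/

section Headline

open Literature.MathematicalPhysics.QuantumFieldTheory (wilsonMeasure GaugeConfig isProbabilityMeasure_wilsonMeasure)
open Summit.QuantumFields.YangMills.Theorems.TunedSequenceExists.Negative.Freezing (re_trace_le_of_mem_unitaryGroup)

variable {G : Type} [Group G] [TopologicalSpace G] [IsTopologicalGroup G] [CompactSpace G]
  [SecondCountableTopology G] [MeasurableSpace G] [BorelSpace G]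
  {N : ℕ} (ρ : G →* Matrix (Fin N) (Fin N) ℂ)

omit [TopologicalSpace G] [IsTopologicalGroup G] [CompactSpace G] [SecondCountableTopology G]
  [MeasurableSpace G] [BorelSpace G] in
/-- The value of the comb-twisted row is STRICTLY below `1` for every `k₀ ≠ 1` (faithful unitary `ρ`, `N ≥ 1`): the
budget hypothesis `2ε < 1 − Re χ_ρ(k₀)/N` of the headline is satisfiable with `ε > 0` on EVERY non-trivial compact `G`. -/
theorem re_trace_div_lt_one (hρi : Function.Injective ρ) (hρu : ∀ g, ρ g ∈ Matrix.unitaryGroup (Fin N) ℂ)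
    (hN : 1 ≤ N) {k₀ : G} (hk₀ : k₀ ≠ 1) : (ρ k₀).trace.re / N < 1 := by
  have hN' : (0 : ℝ) < N := by exact_mod_cast hN
  rw [div_lt_one hN']
  refine lt_of_le_of_ne (re_trace_le_of_mem_unitaryGroup (hρu k₀)) fun h => hk₀ (hρi ?_)
  rw [Literature.Barriers.QuantumFields.eq_one_of_re_trace_eq (hρu _) h, map_one]

/-- **HEADLINE — THE FIXED-MESH NEGATIVE FOR EVERY COMPACT GAUGE GROUP (PROVED, sorry-free).**  For every compact
(second countable) `G`, every continuous faithful unitary `ρ` of degree `N ≥ 1`, every `k₀ : G`, mesh `b ≥ 1`, window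
`n`, and budgets `2ε < 1 − Re χ_ρ(k₀)/N` (satisfiable with `ε > 0` as soon as `k₀ ≠ 1`, `re_trace_div_lt_one`), `0 ≤ δ`,
`4·#windowCellsPlus(n)·δ < 1`:  `∃ β₀ ∀ β ≥ β₀, ¬ TypShellCond ρ β b n ε δ`.
NO centre and NO scalar hypothesis (`ρ g₀ = c • 1`) — the tree's `not_typShellCond_fixedMesh` needs both; this covers
the centre-free groups `SO(3)`, `G₂`, `F₄`, `E₈`, `PSU(N)` and every faithful representation.  Proof: the g5 composition
`not_typShellCond_frame` with the LAYER-COMB twist `κ = comb b ((2n+2)b+1) k₀`, whose two inputs are the theorems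
`topTwistTransfer_comb` (INPUT T, §10: skew-product Fubini along the comb's gauge tree) and `frameValueBound_comb`
(INPUT F, §9: uniform soft Laplace principle + zero-temperature Stokes algebra + torus plaquette freezing). -/
theorem not_typShellCond_fixedMesh_allG (hρ : Continuous ρ) (hρi : Function.Injective ρ)
    (hρu : ∀ g, ρ g ∈ Matrix.unitaryGroup (Fin N) ℂ) (hN : 1 ≤ N) (k₀ : G)
    {b : ℕ} (hb : 1 ≤ b) (n : ℕ) {ε δ : ℝ} (hε : 2 * ε < 1 - (ρ k₀).trace.re / N)
    (hδ0 : 0 ≤ δ) (hδ : 4 * ((windowCellsPlus n).card : ℝ) * δ < 1) :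
    ∃ β₀ : ℝ, ∀ β : ℝ, β₀ ≤ β → ¬ TypShellCond ρ β b n ε δ :=
  not_typShellCond_frame ρ hρ hρi hρu hN hb n (comb b ((2 * n + 2) * b + 1) k₀)
    (topTwistTransfer_comb ρ hb n k₀) (frameValueBound_comb ρ hρ hρu hρi hb n k₀) hε hδ0 hδ

/-- **The onset floor for every compact `G`, uniform on a bounded mesh range** (the all-`G` analogue of the tree's
`typOnsetFloor`): for every mesh bound `B` there is `β₁` with NO mesh `1 ≤ b ≤ B` satisfying format T beyond `β₁` —
the typical onset `b⋆_T(β)` diverges for EVERY non-trivial compact gauge group and faithful `ρ`. -/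
theorem typOnsetFloor_allG (hρ : Continuous ρ) (hρi : Function.Injective ρ)
    (hρu : ∀ g, ρ g ∈ Matrix.unitaryGroup (Fin N) ℂ) (hN : 1 ≤ N) (k₀ : G)
    (n : ℕ) {ε δ : ℝ} (hε : 2 * ε < 1 - (ρ k₀).trace.re / N)
    (hδ0 : 0 ≤ δ) (hδ : 4 * ((windowCellsPlus n).card : ℝ) * δ < 1) (B : ℕ) :
    ∃ β₁ : ℝ, ∀ β : ℝ, β₁ ≤ β → ∀ b : ℕ, 1 ≤ b → b ≤ B → ¬ TypShellCond ρ β b n ε δ := by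
  induction B with
  | zero => exact ⟨0, fun β _ b hb hb0 => absurd hb (by omega)⟩
  | succ B ih =>
    obtain ⟨β₁, h₁⟩ := ih
    obtain ⟨β₀, h₀⟩ :=
      not_typShellCond_fixedMesh_allG ρ hρ hρi hρu hN k₀ (b := B + 1) (by omega) n hε hδ0 hδ
    refine ⟨max β₁ β₀, fun β hβ b hb hbB => ?_⟩
    rcases Nat.lt_or_ge b (B + 1) with hlt | hge
    · exact h₁ β ((le_max_left _ _).trans hβ) b hb (by omega)
    · obtain rfl : b = B + 1 := le_antisymm hbB hge
      exact h₀ β ((le_max_right _ _).trans hβ)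

/-! ### rev 2 — the CLIPPED test: every budget `ε < 1`, every `k₀ ≠ 1`; ROW strength; certideate-2's Props -/

/-- **CORE FOR THE COMB WITH THE CLIPPED TEST (PROVED).**  For `k₀ ≠ 1` put `r = Re χ_ρ(k₀)/N < 1`
(`re_trace_div_lt_one`) and shape the charged test by the clipped affine map
`ψ t = max (-1) (min 1 (2 (t − r)/(1 − r) − 1))`: `ψ 1 = 1`, `ψ r = −1`, `|ψ| ≤ 1`, `1 − ψ t ≤ (2/(1−r)) (1 − t)` for
`t ≤ 1`.  INPUT F for `(comb, ψ)` has value `ψ r = −1` (`frameValueBoundObs_comb`), so the core's budget `2ε < 1 − (−1)`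
is EVERY `ε < 1`: at every fixed mesh, for all large `β`, NO measurable cell-local class satisfies clause (i) at the row
together with the single-cell torus anchor `δ` (`4·#windowCellsPlus(n)·δ < 1`). -/
theorem frame_core_comb_clipped (hρ : Continuous ρ) (hρi : Function.Injective ρ)
    (hρu : ∀ g, ρ g ∈ Matrix.unitaryGroup (Fin N) ℂ) (hN : 1 ≤ N) {k₀ : G} (hk₀ : k₀ ≠ 1)
    {b : ℕ} (hb : 1 ≤ b) (n : ℕ) {ε δ : ℝ} (hε : ε < 1)
    (hδ0 : 0 ≤ δ) (hδ : 4 * ((windowCellsPlus n).card : ℝ) * δ < 1) :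
    ∃ β₀ : ℝ, ∀ β : ℝ, β₀ ≤ β → ∀ Typ : (Fin 4 → ℤ) → Set (LGConfig 4 G),
      (∀ c, MeasurableSet (Typ c)) →
      (∀ c, DependsOn (fun σ : LGConfig 4 G => σ ∈ Typ c) ↑(cellEdges (stdFrame b) c)) →
      RowClauseI ρ β (stdFrame b) n ε Typ →
      (∀ c ∈ windowCellsPlus n,
        (wilsonMeasure (d := 4) (L := 2 * ((2 * n + 2) * b + 1) + 1) ρ β)
          {V | torusLift (2 * ((2 * n + 2) * b + 1) + 1) V ∉ Typ c} ≤ ENNReal.ofReal δ) → False := by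
  obtain ⟨r, hrdef⟩ : ∃ r : ℝ, (ρ k₀).trace.re / N = r := ⟨_, rfl⟩
  have hr : r < 1 := hrdef ▸ re_trace_div_lt_one ρ hρi hρu hN hk₀
  have h1r : 0 < 1 - r := by linarith
  have h1r' : 1 - r ≠ 0 := h1r.ne'
  have hψc : Continuous fun t : ℝ => max (-1) (min 1 (2 * (t - r) / (1 - r) - 1)) :=
    continuous_const.max (continuous_const.min
      (((continuous_const.mul (continuous_id.sub continuous_const)).div_const _).sub continuous_const))
  have hψ1 : ∀ t : ℝ, |t| ≤ 1 → |max (-1) (min 1 (2 * (t - r) / (1 - r) - 1))| ≤ 1 := fun t _ =>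
    abs_le.2 ⟨le_max_left _ _, max_le (by norm_num) (min_le_left _ _)⟩
  have hψA : ∀ t : ℝ, t ≤ 1 → 1 - max (-1) (min 1 (2 * (t - r) / (1 - r) - 1)) ≤ 2 / (1 - r) * (1 - t) := by
    intro t ht
    have hφ : 1 - (2 * (t - r) / (1 - r) - 1) = 2 / (1 - r) * (1 - t) := by
      field_simp
      ring
    have hmin : min 1 (2 * (t - r) / (1 - r) - 1) ≤ max (-1) (min 1 (2 * (t - r) / (1 - r) - 1)) :=
      le_max_right _ _
    rcases le_total 1 (2 * (t - r) / (1 - r) - 1) with h | h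
    · rw [min_eq_left h] at hmin ⊢
      have : 0 ≤ 2 / (1 - r) * (1 - t) := mul_nonneg (div_nonneg (by norm_num) h1r.le) (by linarith)
      linarith
    · rw [min_eq_right h] at hmin ⊢
      linarith
  have hψr : max (-1 : ℝ) (min 1 (2 * (r - r) / (1 - r) - 1)) = -1 := by
    rw [sub_self, mul_zero, zero_div, zero_sub, min_eq_right (by norm_num), max_self]
  have hFψ : FrameValueBoundObs ρ (comb b ((2 * n + 2) * b + 1) k₀) b n
      (fun t : ℝ => max (-1) (min 1 (2 * (t - r) / (1 - r) - 1))) (-1) := by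
    have h := frameValueBoundObs_comb ρ hρ hρu hρi hb n k₀ hψc
    rwa [hrdef, hψr] at h
  exact frame_core ρ hρ hρi hρu hN hb n (comb b ((2 * n + 2) * b + 1) k₀) hψc hψ1
    (div_nonneg (by norm_num) h1r.le) hψA (topTwistTransfer_comb ρ hb n k₀) hFψ (by linarith) hδ0 hδ

/-- **HEADLINE′ (rev 2) — EVERY BUDGET `ε < 1`, EVERY `k₀ ≠ 1` (PROVED, sorry-free).**  For every compact (second
countable) `G`, every continuous faithful unitary `ρ` of degree `N ≥ 1`, every `k₀ ≠ 1`, mesh `b ≥ 1`, window `n`,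
`ε < 1`, `0 ≤ δ`, `4·#windowCellsPlus(n)·δ < 1`:  `∃ β₀ ∀ β ≥ β₀, ¬ TypShellCond ρ β b n ε δ`. -/
theorem not_typShellCond_fixedMesh_allG' (hρ : Continuous ρ) (hρi : Function.Injective ρ)
    (hρu : ∀ g, ρ g ∈ Matrix.unitaryGroup (Fin N) ℂ) (hN : 1 ≤ N) {k₀ : G} (hk₀ : k₀ ≠ 1)
    {b : ℕ} (hb : 1 ≤ b) (n : ℕ) {ε δ : ℝ} (hε : ε < 1)
    (hδ0 : 0 ≤ δ) (hδ : 4 * ((windowCellsPlus n).card : ℝ) * δ < 1) :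
    ∃ β₀ : ℝ, ∀ β : ℝ, β₀ ≤ β → ¬ TypShellCond ρ β b n ε δ := by
  obtain ⟨β₀, hβ₀⟩ := frame_core_comb_clipped ρ hρ hρi hρu hN hk₀ hb n hε hδ0 hδ
  refine ⟨β₀, fun β hβ hTyp => ?_⟩
  obtain ⟨Typ, hmeas, hdep, hI, hanch⟩ := clauseI_of_typShellCond hTyp
  exact hβ₀ β hβ Typ hmeas hdep (rowClauseI_of_clauseI hI) fun c' hc' =>
    hanch ((2 * n + 2) * b + 1) (by nlinarith) c' (stdFrame_windowCellsPlus_bounds hc')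

/-- **The onset floor for every compact `G` at every budget `ε < 1` (rev 2).** -/
theorem typOnsetFloor_allG' (hρ : Continuous ρ) (hρi : Function.Injective ρ)
    (hρu : ∀ g, ρ g ∈ Matrix.unitaryGroup (Fin N) ℂ) (hN : 1 ≤ N) {k₀ : G} (hk₀ : k₀ ≠ 1)
    (n : ℕ) {ε δ : ℝ} (hε : ε < 1)
    (hδ0 : 0 ≤ δ) (hδ : 4 * ((windowCellsPlus n).card : ℝ) * δ < 1) (B : ℕ) :
    ∃ β₁ : ℝ, ∀ β : ℝ, β₁ ≤ β → ∀ b : ℕ, 1 ≤ b → b ≤ B → ¬ TypShellCond ρ β b n ε δ := by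
  induction B with
  | zero => exact ⟨0, fun β _ b hb hb0 => absurd hb (by omega)⟩
  | succ B ih =>
    obtain ⟨β₁, h₁⟩ := ih
    obtain ⟨β₀, h₀⟩ :=
      not_typShellCond_fixedMesh_allG' ρ hρ hρi hρu hN hk₀ (b := B + 1) (by omega) n hε hδ0 hδ
    refine ⟨max β₁ β₀, fun β hβ b hb hbB => ?_⟩
    rcases Nat.lt_or_ge b (B + 1) with hlt | hge
    · exact h₁ β ((le_max_left _ _).trans hβ) b hb (by omega)
    · obtain rfl : b = B + 1 := le_antisymm hbB hge
      exact h₀ β ((le_max_right _ _).trans hβ)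

/-- **ROW STRENGTH (rev 2; PROVED).**  The (weaker) ROW format `RowShellCond` — clause (i) asked ONLY at
`Y = rowCells n` — fails at every fixed mesh for all large `β`, for every compact `G`, faithful unitary `ρ`, `N ≥ 1`,
`k₀ ≠ 1`, `ε < 1`, `0 ≤ δ`, `4·#windowCellsPlus(n)·δ < 1` (only clause (i) at the row and the anchor (iii) at
single cells are used; (ii) is not). -/
theorem not_rowShellCond_fixedMesh_allG (hρ : Continuous ρ) (hρi : Function.Injective ρ)
    (hρu : ∀ g, ρ g ∈ Matrix.unitaryGroup (Fin N) ℂ) (hN : 1 ≤ N) {k₀ : G} (hk₀ : k₀ ≠ 1)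
    {b : ℕ} (hb : 1 ≤ b) (n : ℕ) {ε δ : ℝ} (hε : ε < 1)
    (hδ0 : 0 ≤ δ) (hδ : 4 * ((windowCellsPlus n).card : ℝ) * δ < 1) :
    ∃ β₀ : ℝ, ∀ β : ℝ, β₀ ≤ β → ¬ RowShellCond ρ β b n ε δ := by
  obtain ⟨β₀, hβ₀⟩ := frame_core_comb_clipped ρ hρ hρi hρu hN hk₀ hb n hε hδ0 hδ
  refine ⟨β₀, fun β hβ hRow => ?_⟩
  obtain ⟨Typ, hmeas, hdep, hI, -, hIII⟩ := hRow (stdFrame b) (stdFrame_admissible b)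
  refine hβ₀ β hβ Typ hmeas hdep hI fun c' hc' => ?_
  have h1 := hIII ((2 * n + 2) * b + 1) (by nlinarith) {c'} (Finset.singleton_nonempty c') (fun c hc => by
    rw [Finset.mem_singleton] at hc; subst hc; exact stdFrame_windowCellsPlus_bounds hc')
  simpa using h1

/-- **ROW STRENGTH, U clothes (rev 2; PROVED).**  The same for `RowShellCondUKP`. -/
theorem not_rowShellCondUKP_fixedMesh_allG (hρ : Continuous ρ) (hρi : Function.Injective ρ)
    (hρu : ∀ g, ρ g ∈ Matrix.unitaryGroup (Fin N) ℂ) (hN : 1 ≤ N) {k₀ : G} (hk₀ : k₀ ≠ 1)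
    {b : ℕ} (hb : 1 ≤ b) (n : ℕ) {ε δ : ℝ} (hε : ε < 1)
    (hδ0 : 0 ≤ δ) (hδ : 4 * ((windowCellsPlus n).card : ℝ) * δ < 1) :
    ∃ β₀ : ℝ, ∀ β : ℝ, β₀ ≤ β → ¬ RowShellCondUKP ρ β b n ε δ := by
  obtain ⟨β₀, hβ₀⟩ := frame_core_comb_clipped ρ hρ hρi hρu hN hk₀ hb n hε hδ0 hδ
  refine ⟨β₀, fun β hβ hRow => ?_⟩
  obtain ⟨Typ, hmeas, hdep, hI, -, hIII⟩ := hRow (stdFrame b) (stdFrame_admissible b)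
  refine hβ₀ β hβ Typ hmeas hdep hI fun c' hc' => ?_
  have h1 := hIII ((2 * n + 2) * b + 1) (by nlinarith) {c'} (Finset.singleton_nonempty c') (fun c hc => by
    rw [Finset.mem_singleton] at hc; subst hc; exact stdFrame_windowCellsPlus_bounds hc')
  simpa using h1

/-- **certideate-2's `RowOnsetDivergesAny ρ` HOLDS — for every `ρ`, unconditionally (rev 2; PROVED).**  (Its hypotheses
`Nontrivial G`, continuity, faithfulness, unitarity, `1 ≤ N` are inside the Prop; pick any `k₀ ≠ 1`; its budget
`ε < 1/2` is inside ours `ε < 1`.)  Hence the guard `HasScalarCentre` of the row-onset split is NOT a divergence guard. -/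
theorem rowOnsetDivergesAny_allG : RowOnsetDivergesAny ρ := by
  intro hnt hc hi hu hN b hb n ε δ _ hε2 hδ hδ'
  haveI := hnt
  obtain ⟨k₀, hk₀⟩ := exists_ne (1 : G)
  exact not_rowShellCond_fixedMesh_allG ρ hc hi hu hN hk₀ hb n (by linarith) hδ hδ'

/-- **ctriage-2's S-ROS-6 `RowOnsetDivergesAll ρ` HOLDS (rev 2; PROVED).** -/
theorem rowOnsetDivergesAll_allG : RowOnsetDivergesAll ρ := rowOnsetDivergesAll_of_any (rowOnsetDivergesAny_allG ρ)

/-- **`RowOnsetDivergesAnyU ρ` HOLDS (rev 2; PROVED)** — the U-row format fails at every fixed mesh too. -/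
theorem rowOnsetDivergesAnyU_allG : RowOnsetDivergesAnyU ρ := by
  intro hnt hc hi hu hN b hb n ε δ _ hε2 hδ hδ'
  haveI := hnt
  obtain ⟨k₀, hk₀⟩ := exists_ne (1 : G)
  exact not_rowShellCondUKP_fixedMesh_allG ρ hc hi hu hN hk₀ hb n (by linarith) hδ hδ'

/-- **Nontrivial-`G` corollary (rev 2).**  On every NON-TRIVIAL compact `G`: format T fails at every fixed mesh for all
large `β` at every budget `ε < 1` (no element to choose). -/
theorem not_typShellCond_fixedMesh_of_nontrivial [Nontrivial G] (hρ : Continuous ρ) (hρi : Function.Injective ρ)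
    (hρu : ∀ g, ρ g ∈ Matrix.unitaryGroup (Fin N) ℂ) (hN : 1 ≤ N)
    {b : ℕ} (hb : 1 ≤ b) (n : ℕ) {ε δ : ℝ} (hε : ε < 1)
    (hδ0 : 0 ≤ δ) (hδ : 4 * ((windowCellsPlus n).card : ℝ) * δ < 1) :
    ∃ β₀ : ℝ, ∀ β : ℝ, β₀ ≤ β → ¬ TypShellCond ρ β b n ε δ := by
  obtain ⟨k₀, hk₀⟩ := exists_ne (1 : G)
  exact not_typShellCond_fixedMesh_allG' ρ hρ hρi hρu hN hk₀ hb n hε hδ0 hδ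

end Headline

end Summit.QuantumFields.YangMills.Cruxes.IR.FixedMeshAllG

end
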